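import Summits.ValiantsHypothesis.ValiantsHypothesis.Theorems.MonotoneRestorationOrbitRestorationQPDerivativeTower
import Summits.ValiantsHypothesis.ValiantsHypothesis.Theorems.MonotoneRestorationOrbitRestorationQPWaringJennrichAffine
import Summits.ValiantsHypothesis.ValiantsHypothesis.Theorems.MonotoneRestorationOrbitRestorationQPLevelAction
import HarnessLib

/-!
# The derivative chain of a Waring expression; ΣΛΣ restoration modulo the small-module spanning property

Route MonotoneRestoration, crux `OrbitRestorationQP` (stmt-ValiantsHypothesis-18293), line `depth-three-rung`,
stub A_∞ `stub_sigmaPiSigmaValue`.  Namespace `Summit.ValiantsHypothesis.ValiantsHypothesis.Theorems.DerivativeTower`.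

`…DerivativeTower.lean` restores symmetry from a supported derivative tower.  Here the tower is produced for
ΣΛΣ expressions `f = Σ_{i<r} a_i ℓ_{w_i}^d` (linear forms, ANY `w`, ANY `a`, unbounded `r`):

* `derivChain f m` — the span of the order-`m` partial derivatives of `f` (`derivChain f 0 = ℂ f`,
  `derivChain f (m+1) = ⨆_x ∂_x (derivChain f m)`); `pderiv_mem_derivChain`;
* `derivChain_le_span_pow` — for a Waring expression, `derivChain f m ≤ span{ℓ_{w_i}^{d-m}}`: dimension
  `≤ r` (`finrank_derivChain_le`), homogeneous of degree `d − m` (`isHomogeneous_of_mem_derivChain`);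
* `map_mact_derivChain_le` — for matrix-symmetric `f` every `derivChain f m` is stable under the whole matrix
  action `mact σ τ`;
* `sigmaLambdaSigma_restorable_of_smallModulesSupported` — **CONDITIONAL ΣΛΣ RUNG OF A_∞**: if every
  matrix-stable subspace of polynomials of dimension `≤ r` is spanned by its `k`-supported members (the
  small-degree-modules property of `S_n × S_n`, hypothesis `hKey`), then every matrix-symmetric
  `f = Σ_{i<r} a_i ℓ_{w_i}^d` is `QPOrbitRestorable (k + 6) n f` — no identifiability, no independence, no
  bound on `r` other than through `hKey`.

Honest label: the ΣΛΣ sub-rung of A_∞ modulo ONE representation-theoretic statement (`hKey`, an explicit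
hypothesis here, not a Literature fact); A_∞ and the crux stay open; VP ≠ VNP untouched. [folklore]
-/

noncomputable section

open scoped Classical

-- `Summit.ValiantsHypothesis.ValiantsHypothesis.…` is the tree's single-conjunct layout (Sub = Summit).
set_option linter.dupNamespace false

namespace Summit.ValiantsHypothesis.ValiantsHypothesis.Theorems

namespace DerivativeTower

open MvPolynomial Finset Equiv OrbitRestorationQPDepthThreeRung WaringJennrich LevelStructure

variable {n : ℕ}

/-! ### The derivative chain -/

/-- The partial derivative `∂_x` as a linear endomorphism. [folklore] -/
abbrev pdLin (x : Fin n × Fin n) : MvPolynomial (Fin n × Fin n) ℂ →ₗ[ℂ] MvPolynomial (Fin n × Fin n) ℂ :=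
  ((pderiv x : Derivation ℂ (MvPolynomial (Fin n × Fin n) ℂ) (MvPolynomial (Fin n × Fin n) ℂ)) :
    MvPolynomial (Fin n × Fin n) ℂ →ₗ[ℂ] MvPolynomial (Fin n × Fin n) ℂ)

/-- `pdLin x` is `pderiv x`. [folklore] -/
theorem pdLin_apply (x : Fin n × Fin n) (p : MvPolynomial (Fin n × Fin n) ℂ) : pdLin x p = pderiv x p := rfl

/-- The span of the order-`m` partial derivatives of `f`. [folklore] -/
def derivChain (f : MvPolynomial (Fin n × Fin n) ℂ) : ℕ → Submodule ℂ (MvPolynomial (Fin n × Fin n) ℂ)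
  | 0 => Submodule.span ℂ {f}
  | m + 1 => Submodule.span ℂ {q | ∃ (x : Fin n × Fin n) (p : MvPolynomial (Fin n × Fin n) ℂ),
      p ∈ derivChain f m ∧ q = pderiv x p}

/-- `f ∈ derivChain f 0`. [folklore] -/
theorem mem_derivChain_zero (f : MvPolynomial (Fin n × Fin n) ℂ) : f ∈ derivChain f 0 := by
  show f ∈ Submodule.span ℂ {f}
  exact Submodule.mem_span_singleton_self f

/-- Partial derivatives go one level down the chain. [folklore] -/
theorem pderiv_mem_derivChain {f p : MvPolynomial (Fin n × Fin n) ℂ} {m : ℕ} (hp : p ∈ derivChain f m)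
    (x : Fin n × Fin n) : pderiv x p ∈ derivChain f (m + 1) := by
  show pderiv x p ∈ Submodule.span ℂ {q | ∃ (x : Fin n × Fin n) (p : MvPolynomial (Fin n × Fin n) ℂ),
      p ∈ derivChain f m ∧ q = pderiv x p}
  exact Submodule.subset_span ⟨x, p, hp, rfl⟩

/-- `pderiv x` is the directional derivation along the coordinate direction `e_x`. [folklore] -/
theorem pderiv_eq_D (x : Fin n × Fin n) :
    (pderiv x : Derivation ℂ (MvPolynomial (Fin n × Fin n) ℂ) (MvPolynomial (Fin n × Fin n) ℂ)) =
      D (Pi.single x (1 : ℂ)) := by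
  unfold D pderiv
  congr 1
  funext y
  by_cases h : y = x
  · subst h; simp
  · simp [h]

/-- `pair w e_x = w x`. [folklore] -/
theorem pair_pi_single (w : (Fin n × Fin n) → ℂ) (x : Fin n × Fin n) : pair w (Pi.single x (1 : ℂ)) = w x := by
  simp only [pair, Pi.single_apply, mul_ite, mul_one, mul_zero, Finset.sum_ite_eq', Finset.mem_univ, if_true]

/-- The partial derivative of a scaled power of a linear form. [folklore] -/
theorem pderiv_C_mul_lin_pow (x : Fin n × Fin n) (a : ℂ) (w : (Fin n × Fin n) → ℂ) (e : ℕ) :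
    pderiv x (C a * lin w ^ e) = C (a * (e : ℂ) * w x) * lin w ^ (e - 1) := by
  have h := iterate_D_C_mul_lin_pow (Pi.single x (1 : ℂ)) w a e 1
  simp only [Function.iterate_one, Nat.descFactorial_one, pow_one] at h
  rw [pderiv_eq_D, h, pair_pi_single]

/-- **The derivative chain of a Waring expression is small**: `derivChain f m ≤ span{ℓ_{w_i}^{d-m}}`.
[folklore] -/
theorem derivChain_le_span_pow {r d : ℕ} (w : Fin r → (Fin n × Fin n) → ℂ) (a : Fin r → ℂ)
    {f : MvPolynomial (Fin n × Fin n) ℂ} (hf : f = ∑ i, C (a i) * lin (w i) ^ d) :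
    ∀ m : ℕ, derivChain f m ≤ Submodule.span ℂ (Set.range fun i => lin (w i) ^ (d - m))
  | 0 => by
      rw [derivChain, Submodule.span_le, Set.singleton_subset_iff, SetLike.mem_coe, hf]
      refine Submodule.sum_mem _ fun i _ => ?_
      rw [← smul_eq_C_mul, Nat.sub_zero]
      exact Submodule.smul_mem _ _ (Submodule.subset_span ⟨i, rfl⟩)
  | m + 1 => by
      rw [derivChain, Submodule.span_le]
      rintro _ ⟨x, p, hp, rfl⟩
      have hmap : (Submodule.span ℂ (Set.range fun i => lin (w i) ^ (d - m))).map (pdLin x) ≤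
          Submodule.span ℂ (Set.range fun i => lin (w i) ^ (d - (m + 1))) := by
        rw [Submodule.map_span_le]
        rintro _ ⟨i, rfl⟩
        rw [pdLin_apply]
        have h := pderiv_C_mul_lin_pow x 1 (w i) (d - m)
        rw [map_one, one_mul] at h
        rw [h, ← smul_eq_C_mul, show d - m - 1 = d - (m + 1) by omega]
        exact Submodule.smul_mem _ _ (Submodule.subset_span ⟨i, rfl⟩)
      have := hmap (Submodule.mem_map_of_mem (derivChain_le_span_pow w a hf m hp))
      rwa [pdLin_apply] at this

/-- The derivative chain of a Waring expression is finite-dimensional, of dimension `≤ r`. [folklore] -/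
theorem finrank_derivChain_le {r d : ℕ} (w : Fin r → (Fin n × Fin n) → ℂ) (a : Fin r → ℂ)
    {f : MvPolynomial (Fin n × Fin n) ℂ} (hf : f = ∑ i, C (a i) * lin (w i) ^ d) (m : ℕ) :
    FiniteDimensional ℂ (derivChain f m) ∧ Module.finrank ℂ (derivChain f m) ≤ r := by
  have hle := derivChain_le_span_pow w a hf m
  haveI : FiniteDimensional ℂ (Submodule.span ℂ (Set.range fun i => lin (w i) ^ (d - m))) :=
    FiniteDimensional.span_of_finite ℂ (Set.finite_range _)
  refine ⟨Submodule.finiteDimensional_of_le hle, ?_⟩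
  refine (Submodule.finrank_mono hle).trans ?_
  exact (finrank_range_le_card _).trans (by rw [Fintype.card_fin])

/-- Members of the derivative chain of a Waring expression are homogeneous of degree `d − m`. [folklore] -/
theorem isHomogeneous_of_mem_derivChain {r d : ℕ} (w : Fin r → (Fin n × Fin n) → ℂ) (a : Fin r → ℂ)
    {f : MvPolynomial (Fin n × Fin n) ℂ} (hf : f = ∑ i, C (a i) * lin (w i) ^ d) {m : ℕ}
    {p : MvPolynomial (Fin n × Fin n) ℂ} (hp : p ∈ derivChain f m) : p.IsHomogeneous (d - m) := by
  have hle : Submodule.span ℂ (Set.range fun i => lin (w i) ^ (d - m)) ≤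
      homogeneousSubmodule (Fin n × Fin n) ℂ (d - m) := by
    rw [Submodule.span_le]
    rintro _ ⟨i, rfl⟩
    rw [SetLike.mem_coe, mem_homogeneousSubmodule]
    simpa using (isHomogeneous_lin (K := ℂ) (w i)).pow (d - m)
  exact (mem_homogeneousSubmodule _ _).1 (hle (derivChain_le_span_pow w a hf m hp))

/-! ### Stability under the matrix action -/

/-- `mact` commutes with partial derivatives up to the index permutation. [folklore] -/
theorem mact_pderiv (σ τ : Perm (Fin n)) (x : Fin n × Fin n) (p : MvPolynomial (Fin n × Fin n) ℂ) :
    mact σ τ (pderiv x p) = pderiv (σ x.1, τ x.2) (mact σ τ p) := by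
  rw [mact_apply, mact_apply]
  have hinj : Function.Injective fun q : Fin n × Fin n => (σ q.1, τ q.2) := by
    intro q q' h
    simp only [Prod.mk.injEq] at h
    exact Prod.ext (σ.injective h.1) (τ.injective h.2)
  exact (pderiv_rename hinj x p).symm

/-- **The derivative chain of a matrix-symmetric polynomial is stable under the matrix action.** [folklore] -/
theorem mact_mem_derivChain {f : MvPolynomial (Fin n × Fin n) ℂ} (hsym : ∀ σ τ : Perm (Fin n), mact σ τ f = f)
    (σ τ : Perm (Fin n)) : ∀ (m : ℕ) {p : MvPolynomial (Fin n × Fin n) ℂ},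
      p ∈ derivChain f m → mact σ τ p ∈ derivChain f m
  | 0, p, hp => by
      rw [derivChain, Submodule.mem_span_singleton] at hp ⊢
      obtain ⟨c, rfl⟩ := hp
      exact ⟨c, by rw [map_smul, hsym]⟩
  | m + 1, p, hp => by
      have hmap : (derivChain f (m + 1)).map (mact σ τ).toLinearEquiv.toLinearMap ≤ derivChain f (m + 1) := by
        rw [derivChain, Submodule.map_span_le]
        rintro _ ⟨x, q, hq, rfl⟩
        show mact σ τ (pderiv x q) ∈ _
        rw [mact_pderiv]
        exact Submodule.subset_span ⟨(σ x.1, τ x.2), mact σ τ q, mact_mem_derivChain hsym σ τ m hq, rfl⟩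
      exact hmap (Submodule.mem_map_of_mem hp)

/-! ### The conditional ΣΛΣ rung -/

/-- **ΣΛΣ RESTORATION MODULO THE SMALL-MODULES SPANNING PROPERTY.**  Suppose (`hKey`) that every subspace of
polynomials on the `n × n` matrix that is finite-dimensional of dimension `≤ r` and stable under the whole
matrix action is spanned by its members supported on `≤ k` indices (a statement of the representation theory
of `S_n × S_n`: modules of small dimension have small depth).  Then every matrix-symmetric Waring expression
`f = Σ_{i<r} a_i ℓ_{w_i}^d` — any coefficients, any linear forms, any `d` — is `QPOrbitRestorable (k+6) n f`.
[folklore] -/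
theorem sigmaLambdaSigma_restorable_of_smallModulesSupported {k r d : ℕ}
    (hKey : ∀ W : Submodule ℂ (MvPolynomial (Fin n × Fin n) ℂ), FiniteDimensional ℂ W →
      Module.finrank ℂ W ≤ r → (∀ σ τ : Perm (Fin n), ∀ w ∈ W, mact σ τ w ∈ W) →
        W ≤ Submodule.span ℂ {v | v ∈ W ∧ ∃ Y : Finset (Fin n), Y.card ≤ k ∧
          ∀ ρ : Perm (Fin n), (∀ i ∈ Y, ρ i = i) → ren ρ v = v})
    (w : Fin r → (Fin n × Fin n) → ℂ) (a : Fin r → ℂ) {f : MvPolynomial (Fin n × Fin n) ℂ}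
    (hf : f = ∑ i, C (a i) * lin (w i) ^ d) (hsym : ∀ σ τ : Perm (Fin n), mact σ τ f = f) :
    QPOrbitRestorable (k + 6) n f := by
  -- supported members of each level span it: pick finite spanning sets
  let Supp : ℕ → Set (MvPolynomial (Fin n × Fin n) ℂ) := fun m =>
    {v | v ∈ derivChain f m ∧ ∃ Y : Finset (Fin n), Y.card ≤ k ∧
      ∀ ρ : Perm (Fin n), (∀ i ∈ Y, ρ i = i) → ren ρ v = v}
  have hspan : ∀ m, derivChain f m ≤ Submodule.span ℂ (Supp m) := fun m =>
    hKey _ (finrank_derivChain_le w a hf m).1 (finrank_derivChain_le w a hf m).2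
      (fun σ τ v hv => mact_mem_derivChain hsym σ τ m hv)
  have hfin : ∀ m, ∃ T : Finset (MvPolynomial (Fin n × Fin n) ℂ), (↑T : Set _) ⊆ Supp m ∧
      derivChain f m ≤ Submodule.span ℂ (T : Set _) := by
    intro m
    haveI := (finrank_derivChain_le w a hf m).1
    obtain ⟨S₀, hS₀⟩ := (Submodule.fg_iff_finiteDimensional _).2 (finrank_derivChain_le w a hf m).1
    have hch : ∀ s ∈ S₀, ∃ F : Finset (MvPolynomial (Fin n × Fin n) ℂ), (↑F : Set _) ⊆ Supp m ∧
        s ∈ Submodule.span ℂ (F : Set _) := by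
      intro s hs
      have hs' : s ∈ derivChain f m := by rw [← hS₀]; exact Submodule.subset_span hs
      exact Submodule.mem_span_finite_of_mem_span (hspan m hs')
    choose F hF using hch
    refine ⟨S₀.attach.biUnion fun s => F s.1 s.2, ?_, ?_⟩
    · intro v hv
      simp only [Finset.coe_biUnion, Finset.coe_attach, Set.mem_univ, Set.iUnion_true, Set.mem_iUnion] at hv
      obtain ⟨s, hv⟩ := hv
      exact (hF s.1 s.2).1 hv
    · rw [← hS₀, Submodule.span_le]
      intro s hs
      have h := (hF s hs).2
      refine Submodule.span_mono ?_ h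
      intro v hv
      simp only [Finset.coe_biUnion, Finset.coe_attach, Set.mem_univ, Set.iUnion_true, Set.mem_iUnion]
      exact ⟨⟨s, hs⟩, hv⟩
  choose T hT using hfin
  -- the tower: add `f` at level `0`
  let T' : ℕ → Finset (MvPolynomial (Fin n × Fin n) ℂ) := fun m => if m = 0 then insert f (T 0) else T m
  have hT'sub : ∀ m, ∀ t ∈ T' m, t ∈ derivChain f m ∧ ∃ Y : Finset (Fin n), Y.card ≤ k ∧
      ∀ ρ : Perm (Fin n), (∀ i ∈ Y, ρ i = i) → ren ρ t = t := by
    intro m t ht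
    by_cases hm : m = 0
    · subst hm
      simp only [T', if_true, Finset.mem_insert] at ht
      rcases ht with rfl | ht
      · refine ⟨mem_derivChain_zero _, ∅, by simp, fun ρ _ => ?_⟩
        rw [ren_eq_mact]; exact hsym ρ ρ
      · exact (hT 0).1 ht
    · simp only [T', if_neg hm] at ht
      exact (hT m).1 ht
  have hT'span : ∀ m, derivChain f m ≤ Submodule.span ℂ (T' m : Set _) := by
    intro m
    refine (hT m).2.trans (Submodule.span_mono ?_)
    by_cases hm : m = 0
    · subst hm; simp only [T', if_true, Finset.coe_insert]; exact Set.subset_insert _ _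
    · simp only [T', if_neg hm]; exact le_rfl
  refine qpOrbitRestorable_of_tower (d := d) T' (fun m t ht => isHomogeneous_of_mem_derivChain w a hf (hT'sub m t ht).1)
    (fun m t ht => (hT'sub m t ht).2) (fun m _ t ht x => hT'span (m + 1) (pderiv_mem_derivChain (hT'sub m t ht).1 x))
    (by simp [T']) fun σ => ?_
  rw [ren_eq_mact]; exact hsym σ σ

end DerivativeTower

end Summit.ValiantsHypothesis.ValiantsHypothesis.Theorems

end
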